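import Summits.BirchSwinnertonDyer.Rank1Residual.Additive.RamifiedSevenGenusPartnerFP1Exact
import Summits.BirchSwinnertonDyer.Rank1Residual.Additive.RamifiedSevenGenusKatoExpUnitLawsOfFP1
import HarnessLib

set_option autoImplicit false

/-!
# `𝒞₇` genus road (crux `EllipticUnitValueSevenOfGZK`, K7r), (K-2★) part 2/3: KATO'S 7-ADIC ★-VALUE LAW ON A RECORD-FED PINNED FRAME
# **WITH ITS PERIOD POSITION** — g35's `PinnedKatoGenusFrame.unitLaws_of_FP1` re-run on F-P1-EXACT′, plus the position equation `R`

Cell bsd-cm, seat bsd-cm-k-ty1 g36; pen D1172 (2)/D1173 (letter (R-a)); critic NOTE #39 (B).  PURE KERNEL (theorems only; g35's proof COPIED,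
the landed file untouched).  Inputs as in part 1 (`hFP1x`, `hTA2`, `hCMT`, `hMP`, `hLev`, `hR`).

THE POSITION BOOKKEEPING (pen D1172 (2): displayed line by line; each line is a `have` of the proof).  Part 1 delivers, at ONE realised family
of the member, (P) `(7^{a₁}M) • zOne = (u₁ 7^{a₂} 7^k) • y` (`a₁ = (−e₁)⁺`, `a₂ = e₁⁺`, `e₁ := v₇(perRatio/(q·q⁻))`, `plusPeriod nf = perRatio·Ω_W`),
(F) F-P1-EXACT′'s class identity at the partner read on the member, and (E″).  g35's witnesses (unchanged): `uStar := u₁·w⁻¹`, `e′ := a₁ + j`,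
`(α₀′, α₁′) := 7^{a₂+k+t}·ν_u⁻¹·(uα₀, ∓u²α₁)`, `u := D₃.u = e ∈ ℤ₇ˣ`, `ν := (uα₀)² + 7(u²α₁)² = ν_u·7^j`.  THEN:
  (1) `v₇(α₀′² + 7α₁′²) = 2(a₂ + k + t) + j`            (`α₀′² + 7α₁′² = (ν_u⁻¹·7^{a₂+k+t})²·ν`, `ε² = 1`; `v₇(unit) = 0`, `v₇(7) = 1`);
  (2) `j = v₇(α₀² + 7α₁²)`                              (parity lemma of part 1: `v((ux)² + 7(u²y)²) = v(x² + 7y²)`; NOTE #33 (d) anisotropy: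
                                                          `v(x²)` is even, `v(7y²)` odd, they never cancel);
  (3) `v₇(α₀² + 7α₁²) = 2t + 2e₂ − v₇(Nm κ′)`           ((E) of EXACT′ at the partner, `e₂ := v₇(ϖ/(q·q⁻))`, `plusPeriod nf = ϖ·Ω_{W₂}`);
  (4) `a₂ − a₁ = e₁`, `e₁ − e₂ = v₇(perRatio/ϖ) = v₇(r)` for ANY `r ∈ ℚ` with `r·Ω_W = Ω_{W₂}` ((3)+(4) = part 1's (E″));
  (R) `v₇(α₀′² + 7α₁′²) − 2e′ = 2(a₂ − a₁) + 2k + 2t − j = 2·Φ.k + 2·v₇(r) + v₇(Nm κ′)`.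
So `R := 2 * (Φ.k : ℤ) + 2 * padicValRat 7 r + padicValRat 7 (Algebra.norm ℚ κ')` — explicit in the frame integer `Φ.k`, the real-period ratio
`r` of the `ℚ`-isogeny pair `(W, D₃.W₂)` (∀-antecedent `(r : ℝ) * W.realPeriodRat = D₃.W₂.realPeriodRat`; in truth a `7`-unit — print, not
kernel, pen D1173 (2)(ii)) and EXACT′'s Betti number `κ′` of the partner (∀-antecedents `L, lam0, κ′` = EXACT′'s clause read at `D₃.W₂` through the
frame's `Kcm, ι₀, s`); `Φ.a`-free.  (S-P) (pen, touch (12)) is then `2 * padicValRat 7 r + padicValRat 7 (Algebra.norm ℚ κ') ≤ (Φ.a : ℤ)`.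

HONEST LABEL: kernel theorems CONDITIONAL on the displayed named facts (`hFP1x` F-P1-EXACT′, `hTA2` (T-A2)′, `hCMT`, `hMP`, `hLev`) and on
the stub's `hR`; the Betti data and `r` are ∀-antecedents, NOT shown to exist here (their existence and the bound `R ≤ 2Φ.k + Φ.a` are the
pen's research stub (S-P) = LEMMA P); (S-★′) needs in addition the rigidity (T-R); these files close NO stub by themselves;
stmt-BirchSwinnertonDyer-19945 stays OPEN (zp v22 21191cec33e1747a, 4 sorries); `X12.CMRamifiedSeven` is NOT proved; no summit statement is
proved by this seat; BSD is claimed for no curve.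

## References
* K. Kato, Astérisque 295 (2004): Thm. 12.5 (1) (p. 221), §13.9 and Lemma 13.10 (1) (p. 230), Prop. 15.9 (15.9.1) (pp. 258–259), Lemma 15.11 (2)
  (pp. 261–262), (15.12.1) (p. 263), 15.14 (p. 264), (15.16.1) (p. 265). [Kato2004Asterisque]
* T. Dokchitser, V. Dokchitser, Trans. AMS 367 (2015), §4 Lemma 10–11. [DokchitserDokchitser2015LocalInvariants]
* J. H. Silverman, *AEC* (2009), Thm. VI.5.1, Prop. VI.3.6 (b), C.16. [SilvermanAEC2009]   L. Washington (1997), Thm. 7.3, §13.2. [Washington1997]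
* Tree: g35 `Additive/RamifiedSevenGenusPartnerFP1.lean` (p826701), `Additive/RamifiedSevenGenusKatoExpUnitLawsOfFP1.lean` (p826824);
  `Kato2004/EllipticUnitZetaClassComparisonExactScaled.lean` (p828201), `Kato2004/DefinedExpStarBodyIsogenyTransportNeron.lean` (p828320),
  `DokchitserDokchitser2015/PadicLogIsogenyInvariance.lean` (p827831); zp v22 `Cruxes/EllipticUnitValueSevenOfGZK/Lines/kato_perrin_riou_zp.lean` l.985–1025.
-/

noncomputable section

open scoped NumberField TensorProduct
open WeierstrassCurve Field NumberField IsDedekindDomain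
open Literature.NumberTheory.IwasawaTheory
open Literature.NumberTheory.GaloisRepresentations Literature.NumberTheory.GaloisRepresentations.LocalWeilDatum
open Literature.NumberTheory.EllipticCurves
open Literature.NumberTheory.EllipticCurves.Rank1Residual
open Literature.NumberTheory.EllipticCurves.IwasawaAlgebra
open Literature.NumberTheory.EllipticCurves.Kato2004
open Literature.NumberTheory.EllipticCurves.ModularForms
open Literature.NumberTheory.ComplexMultiplication.EllipticUnits
open Summit.BirchSwinnertonDyer.Rank1Residual

namespace Summit.BirchSwinnertonDyer.Rank1Residual.Additive.GenusSeven

/-! ## §2 ★★ The ★-value law WITH POSITION on a pinned frame fed by a record -/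

section Frame

variable {W : WeierstrassCurve ℚ} [W.IsElliptic] [W.IsGloballyMinimal] [Fact (Nat.Prime 7)]
  [ContinuousSMul ℤ_[7] (W.tateModule 7)] {K : ZpExtension ℚ 7} {hK : K.IsCyclotomic}
  {γ : Field.absoluteGaloisGroup ℚ} {I : IwasawaH1Data W 7 K γ}
  {F : GenusFrame} {θu : ∀ n : ℕ, globalUnitsOf (F.layer n)} {d : GenusDatum F θu}

set_option maxHeartbeats 4000000 in
/-- ★★ **KATO'S 7-ADIC ★-VALUE LAW WITH ITS PERIOD POSITION, on a pinned frame fed by a Kummer column record** (module docstring): g35's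
`PinnedKatoGenusFrame.unitLaws_of_FP1` (law VERBATIM, same witnesses `uStar := u₁·w⁻¹`, `e′ := a₁ + j`, `(α₀′, α₁′) := 7^{a₂+k+t}·ν_u⁻¹·(uα₀, ∓u²α₁)`),
now from F-P1-EXACT′ + (T-A2)′, AND the position equation `v₇(α₀′² + 7α₁′²) − 2e′ = 2·Φ.k + 2·v₇(r) + v₇(Nm κ′)` (lines (1)–(4), (R) of the
module docstring), under the Betti / period-ratio ∀-antecedents `(L, hNL, lam0, hlam0, κ′, hκ′, r, hr)` read at the partner `D₃.W₂` through the
frame's `Kcm, ι₀, s`.  CONDITIONAL on the displayed named facts `hFP1x`, `hTA2`, `hCMT`, `hMP`, `hLev`.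
[cite: Kato2004Asterisque, Thm. 12.5 (1) (p. 221), §13.9 and Lemma 13.10 (1) (p. 230), Prop. 15.9 (15.9.1) (pp. 258–259), Lemma 15.11 (2) (pp. 261–262), 15.14 (p. 264), (15.16.1) (p. 265)]
[cite: Washington1997, Thm. 7.3 and §13.2] -/
theorem PinnedKatoGenusFrame.unitLawsWithPosition_of_FP1exact
    (hFP1x : CM.kato15161_ellipticUnitClass_res_zetaFamily_exact')
    (hTA2 : DokchitserDokchitser2015.padicLogLocal_dual_eq_of_isogenyPair_coprime) (hCMT : CM.artin_natCast_smul_torsion)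
    (hMP : nonempty_modularParametrizationData)
    (hLev : ∀ {N : ℕ} [NeZero N], IsNewformOf.level_eq_conductorNorm (N := N))
    (hγ : K.IsTopGenerator γ) (hR : ∃ z₀ : I.H, IsAdmissibleZetaClass W 7 K hK I z₀)
    (Φ : PinnedKatoGenusFrame W K hK I d)
    (s : 𝓞 Φ.Kcm) (hs : Φ.sqrtNegSeven = (s : Φ.Kcm)) (h𝔣 : Φ.𝔣 = Ideal.span {s} * Ideal.span {((F.d : ℕ) : 𝓞 Φ.Kcm)})
    (ι₀ : Φ.Kcm →+* ℂ) (hι₀ : ∀ (w : InfinitePlace Φ.Kcm) (x : Φ.Kcm), ι₀ x = w.embedding x)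
    (D₃ : KummerColumnDataRat W Φ.Kcm Φ.finrank_Kcm K Φ.IK ι₀ Φ.𝔣 F.d Φ.φ)
    (hψ : Φ.ψ = D₃.ψ) (heuK : Φ.euK = D₃.euK) (h𝔏 : Φ.𝔏 = D₃.𝔏) (ι₇ : ℚ_[7] →+* ℂ)
    (L : PeriodPair) (hNL : IsNeronLatticeOf (D₃.W₂.baseChange ℂ) L) (lam0 : ℂ)
    (hlam0 : ∀ zz : ℂ, zz ∈ L.lattice ↔ ∃ a : 𝓞 Φ.Kcm, zz = lam0 * ι₀ (a : Φ.Kcm))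
    (κ' : Φ.Kcm) (hκ' : ι₀ κ' * ((D₃.W₂.realPeriodRat : ℝ) : ℂ) = ι₀ (s : Φ.Kcm) * lam0)
    (r : ℚ) (hr : (r : ℝ) * W.realPeriodRat = D₃.W₂.realPeriodRat) :
    ∃ (uStar : (IwasawaAlgebra 7)ˣ) (e' : ℕ) (α₀ α₁ : ℤ_[7]) (_ : α₀ ≠ 0 ∨ α₁ ≠ 0) (n₀ : ℕ),
      (∀ (n : ℕ), n₀ ≤ n → ∀ (χ : absoluteGaloisGroup Φ.Kcm →ₜ* ℂˣ),
        (∀ σ ∈ Φ.towerK.layerSubgroup (n + 1), χ σ = 1) →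
        IsPrimitiveRoot (((χ Φ.γK : ℂˣ)) : ℂ) (7 ^ (n + 1)) →
        ∀ Lf : ℂ → ℂ, CM.IsDepletedHeckeL Φ.ψ χ (7 * (7 * F.d)) Lf →
          (7 : ℂ) ^ e' * Φ.valOf ι₇ χ (uStar⁻¹ • I.resOver Φ.IK hγ Φ.isTopGenerator_γK Φ.zOne) =
            (ι₇ (α₀ : ℚ_[7]) + ι₇ (α₁ : ℚ_[7]) * Φ.ιC (algebraMap Φ.Kcm (AlgebraicClosure Φ.Kcm) Φ.sqrtNegSeven)) * Φ.Ω⁻¹ * Lf 1) ∧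
      (((α₀ ^ 2 + 7 * α₁ ^ 2).valuation : ℕ) : ℤ) - 2 * (e' : ℤ) =
        2 * (Φ.k : ℤ) + 2 * padicValRat 7 r + padicValRat 7 (Algebra.norm ℚ κ') := by
  classical
  have hs2 : ((s : Φ.Kcm)) ^ 2 = -7 := by rw [← hs]; exact Φ.sqrtNegSeven_sq
  have h𝔣dvd : Φ.𝔣 ∣ Ideal.span {((7 * F.d : ℕ) : 𝓞 Φ.Kcm)} := by
    rw [h𝔣]
    exact span_sqrt_mul_span_natCast_dvd_span_seven_mul s hs2 F.d
  -- (T5)+(T6): the two class identities at ONE realised family of the member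
  obtain ⟨M, hM, y, u₁, w, a₁, a₂, t, α₀, α₁, hα, hP, hEx, hF⟩ :=
    PartnerFP1.position_and_member_identity_exact hFP1x hTA2 hCMT hMP hLev K hK hγ I hR Φ.zOne_pos F.odd_d Φ.bad_iff_dvd
      Φ.Kcm Φ.finrank_Kcm s hs2 ι₀ hι₀ Φ.isTopGenerator_γK Φ.IK Φ.φ Φ.φ_sq h𝔣dvd D₃ L hNL lam0 hlam0 κ' hκ' r hr
  -- (e2) up to orientation, from the record's (lin)
  obtain ⟨ε, hε, hE2⟩ : ∃ ε : ℤ, (ε = 1 ∨ ε = -1) ∧ ∀ (χ : absoluteGaloisGroup Φ.Kcm →ₜ* ℂˣ) (x : Φ.IK.H),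
      Φ.valOf ι₇ χ (Φ.IK.isogenyMap Φ.φ Φ.IK Φ.isTopGenerator_γK x) =
        (ε : ℂ) * Φ.ιC (algebraMap Φ.Kcm (AlgebraicClosure Φ.Kcm) Φ.sqrtNegSeven) * Φ.valOf ι₇ χ x := by
    have hlin : ∀ (m : ℕ) (c : H1 (CM.tateRepK (W.baseChange Φ.Kcm) 7) (CM.torsionLayer (W.baseChange Φ.Kcm) (7 ^ m * (7 * F.d)))),
        Φ.𝔏 (CM.torsionLayer (W.baseChange Φ.Kcm) (7 ^ m * (7 * F.d)))
            (isogenyLayerMapK 7 Φ.φ (CM.torsionLayer (W.baseChange Φ.Kcm) (7 ^ m * (7 * F.d))) c) =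
          ((1 : ℚ_[7]) ⊗ₜ[ℤ] algebraMap Φ.Kcm (AlgebraicClosure Φ.Kcm) D₃.μ) *
            Φ.𝔏 (CM.torsionLayer (W.baseChange Φ.Kcm) (7 ^ m * (7 * F.d))) c := by
      rw [h𝔏]
      exact D₃.lin
    rcases Φ.expStarCMShape_or_negSqrt D₃.μ_sq hlin with h | h
    · exact ⟨1, Or.inl rfl, fun χ x ↦ by rw [← Φ.piK_eq_isogenyMap, Φ.valOf_piK_of_expStarCM h, Int.cast_one, one_mul]⟩
    · refine ⟨-1, Or.inr rfl, fun χ x ↦ ?_⟩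
      have h' : Φ.valOf ι₇ χ (Φ.piK x) = Φ.ιC (algebraMap Φ.Kcm (AlgebraicClosure Φ.Kcm) (-Φ.sqrtNegSeven)) * Φ.valOf ι₇ χ x :=
        Φ.negSqrt.valOf_piK_of_expStarCM h ι₇ χ x
      rw [map_neg, map_neg] at h'
      rw [← Φ.piK_eq_isogenyMap, Int.cast_neg, Int.cast_one, neg_one_mul]
      exact h'
  -- the threshold: Kato's multiplier does not vanish at primitive characters of large level ((M-CANCEL), Weierstrass preparation)
  obtain ⟨n₀, hn₀⟩ := Φ.exists_level_forall_charEval_ne_zero ι₇ hM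
  -- the constants
  have hμC2 : ((ε : ℂ) * Φ.ιC (algebraMap Φ.Kcm (AlgebraicClosure Φ.Kcm) Φ.sqrtNegSeven)) ^ 2 = -7 := by
    have hε2 : (ε : ℂ) ^ 2 = 1 := by rcases hε with rfl | rfl <;> norm_num
    rw [mul_pow, hε2, one_mul, ← map_pow, ← map_pow, Φ.sqrtNegSeven_sq, map_neg, map_ofNat, map_neg, map_ofNat]
  have huD : (D₃.u : ℤ_[7]) ≠ 0 := Units.ne_zero _
  have hγ01 : (D₃.u : ℤ_[7]) * α₀ ≠ 0 ∨ (D₃.u : ℤ_[7]) ^ 2 * α₁ ≠ 0 :=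
    hα.imp (fun h ↦ mul_ne_zero huD h) (fun h ↦ mul_ne_zero (pow_ne_zero _ huD) h)
  have hA0 : ι₇ (((D₃.u : ℤ_[7]) * α₀ : ℤ_[7]) : ℚ_[7]) +
      ι₇ (((D₃.u : ℤ_[7]) ^ 2 * α₁ : ℤ_[7]) : ℚ_[7]) * ((ε : ℂ) * Φ.ιC (algebraMap Φ.Kcm (AlgebraicClosure Φ.Kcm) Φ.sqrtNegSeven)) ≠ 0 :=
    fun h0 ↦ by
    obtain ⟨h1, h2⟩ := CharacterEvaluation.eq_zero_of_add_mul_eq_zero_of_sq_eq_neg_seven ι₇ hμC2 h0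
    rcases hγ01 with h | h
    · exact h (PadicInt.coe_eq_zero.mp h1)
    · exact h (PadicInt.coe_eq_zero.mp h2)
  have hB0 : ι₇ (((D₃.u : ℤ_[7]) * α₀ : ℤ_[7]) : ℚ_[7]) -
      ι₇ (((D₃.u : ℤ_[7]) ^ 2 * α₁ : ℤ_[7]) : ℚ_[7]) * ((ε : ℂ) * Φ.ιC (algebraMap Φ.Kcm (AlgebraicClosure Φ.Kcm) Φ.sqrtNegSeven)) ≠ 0 :=
    fun h0 ↦ by
    have h0' : ι₇ (((D₃.u : ℤ_[7]) * α₀ : ℤ_[7]) : ℚ_[7]) + ι₇ ((-((D₃.u : ℤ_[7]) ^ 2 * α₁) : ℤ_[7]) : ℚ_[7]) *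
        ((ε : ℂ) * Φ.ιC (algebraMap Φ.Kcm (AlgebraicClosure Φ.Kcm) Φ.sqrtNegSeven)) = 0 := by
      rw [PadicInt.coe_neg, map_neg, neg_mul, ← sub_eq_add_neg]
      exact h0
    obtain ⟨h1, h2⟩ := CharacterEvaluation.eq_zero_of_add_mul_eq_zero_of_sq_eq_neg_seven ι₇ hμC2 h0'
    rcases hγ01 with h | h
    · exact h (PadicInt.coe_eq_zero.mp h1)
    · rw [PadicInt.coe_neg, neg_eq_zero] at h2
      exact h (PadicInt.coe_eq_zero.mp h2)
  have hAB : (ι₇ (((D₃.u : ℤ_[7]) * α₀ : ℤ_[7]) : ℚ_[7]) +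
        ι₇ (((D₃.u : ℤ_[7]) ^ 2 * α₁ : ℤ_[7]) : ℚ_[7]) * ((ε : ℂ) * Φ.ιC (algebraMap Φ.Kcm (AlgebraicClosure Φ.Kcm) Φ.sqrtNegSeven))) *
      (ι₇ (((D₃.u : ℤ_[7]) * α₀ : ℤ_[7]) : ℚ_[7]) -
        ι₇ (((D₃.u : ℤ_[7]) ^ 2 * α₁ : ℤ_[7]) : ℚ_[7]) * ((ε : ℂ) * Φ.ιC (algebraMap Φ.Kcm (AlgebraicClosure Φ.Kcm) Φ.sqrtNegSeven))) =
      ι₇ ((((D₃.u : ℤ_[7]) * α₀) ^ 2 + 7 * ((D₃.u : ℤ_[7]) ^ 2 * α₁) ^ 2 : ℤ_[7]) : ℚ_[7]) := by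
    have h7 : ι₇ ((7 : ℤ_[7]) : ℚ_[7]) = 7 := by rw [show ((7 : ℤ_[7]) : ℚ_[7]) = 7 from rfl, map_ofNat]
    simp only [PadicInt.coe_add, PadicInt.coe_mul, PadicInt.coe_pow, map_add, map_mul, map_pow, h7]
    linear_combination (-(ι₇ ((D₃.u : ℤ_[7]) : ℚ_[7]) ^ 4 * ι₇ ((α₁ : ℤ_[7]) : ℚ_[7]) ^ 2)) * hμC2
  have hν0 : ((D₃.u : ℤ_[7]) * α₀) ^ 2 + 7 * ((D₃.u : ℤ_[7]) ^ 2 * α₁) ^ 2 ≠ 0 := fun h0 ↦ by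
    have h1 : ι₇ ((((D₃.u : ℤ_[7]) * α₀) ^ 2 + 7 * ((D₃.u : ℤ_[7]) ^ 2 * α₁) ^ 2 : ℤ_[7]) : ℚ_[7]) = 0 := by
      rw [h0, PadicInt.coe_zero, map_zero]
    rw [← hAB, mul_eq_zero] at h1
    exact h1.elim hA0 hB0
  have hνfac := PadicInt.unitCoeff_spec hν0
  -- the witnesses
  refine ⟨u₁ * w⁻¹, a₁ + (((D₃.u : ℤ_[7]) * α₀) ^ 2 + 7 * ((D₃.u : ℤ_[7]) ^ 2 * α₁) ^ 2).valuation,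
    ((7 ^ (a₂ + Φ.k + t) : ℕ) : ℤ_[7]) * ((PadicInt.unitCoeff hν0)⁻¹ : ℤ_[7]ˣ) * ((D₃.u : ℤ_[7]) * α₀),
    -(ε : ℤ_[7]) * (((7 ^ (a₂ + Φ.k + t) : ℕ) : ℤ_[7]) * ((PadicInt.unitCoeff hν0)⁻¹ : ℤ_[7]ˣ) * ((D₃.u : ℤ_[7]) ^ 2 * α₁)),
    ?_, n₀, fun n hn χ hχ hprim Lf hLf ↦ ?_, ?_⟩
  · -- `(α₀′, α₁′) ≠ 0`
    have h7 : ((7 ^ (a₂ + Φ.k + t) : ℕ) : ℤ_[7]) ≠ 0 := by exact_mod_cast pow_ne_zero _ (by norm_num : (7 : ℕ) ≠ 0)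
    have hνu : (((PadicInt.unitCoeff hν0)⁻¹ : ℤ_[7]ˣ) : ℤ_[7]) ≠ 0 := Units.ne_zero _
    have hε0 : (ε : ℤ_[7]) ≠ 0 := by rcases hε with rfl | rfl <;> simp
    rcases hγ01 with h | h
    · exact Or.inl (mul_ne_zero (mul_ne_zero h7 hνu) h)
    · exact Or.inr (mul_ne_zero (neg_ne_zero.mpr hε0) (mul_ne_zero (mul_ne_zero h7 hνu) h))
  -- THE LAW at `χ`.  First the rational twist `β = 42·(7d) + 1` and its bookkeeping
  have hζN := Φ.inv_chi_γK_pow_eq_one χ hχ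
  have h7 : ι₇ ((7 : ℤ_[7]) : ℚ_[7]) = 7 := by rw [show ((7 : ℤ_[7]) : ℚ_[7]) = 7 from rfl, map_ofNat]
  have hιu : ι₇ ((D₃.u : ℤ_[7]) : ℚ_[7]) ≠ 0 := by
    rw [map_ne_zero]
    exact PadicInt.coe_ne_zero.mpr huD
  have hd0 : F.d ≠ 0 := by
    intro h0
    exact (Nat.not_odd_iff_even.mpr (by rw [h0]; decide)) F.odd_d
  set β : ℕ := 6 * 7 * (7 * F.d) + 1 with hβdef
  have hβ : 1 < β := by omega
  have hβc : β.Coprime (6 * 7 * (7 * F.d)) := Nat.coprime_self_add_left.mpr (Nat.coprime_one_left _)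
  have hβf : ((7 * F.d : ℕ) : 𝓞 Φ.Kcm) ∣ ((β : ℕ) : 𝓞 Φ.Kcm) - 1 := ⟨((6 * 7 : ℕ) : 𝓞 Φ.Kcm), by rw [hβdef]; push_cast; ring⟩
  have hTw : IsTwist 7 Φ.𝔣 (Ideal.span {((β : ℕ) : 𝓞 Φ.Kcm)}) := PartnerFP1.isTwist_span_natCast Φ.finrank_Kcm h𝔣dvd hβ hβc
  have hN𝔟 : Ideal.absNorm (Ideal.span {((β : ℕ) : 𝓞 Φ.Kcm)}) = β ^ 2 := absNorm_span_natCast Φ.finrank_Kcm β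
  have hβ0 : ((β : ℕ) : 𝓞 Φ.Kcm) ≠ 0 := by exact_mod_cast (show β ≠ 0 by omega)
  have hψβ : CM.heckeCharIdealValue Φ.ψ (Ideal.span {((β : ℕ) : 𝓞 Φ.Kcm)}) = (β : ℂ) := by
    rw [hψ, D₃.ψ_conductor _ hβ0 hβf, algClosureEmb_algebraMap]
    simp
  -- `χ((β)) = ζ^{−m}` and `σ_{(β)}` acts by `ζ^m`, for the SAME `m`
  set m : ℕ := (PadicInt.toZModPow (n + 1)
    (ZpExtension.artinExponent (K.restrictOfFinrankEqTwo (by decide) Φ.Kcm Φ.finrank_Kcm) (Ideal.span {((β : ℕ) : 𝓞 Φ.Kcm)}))).val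
    with hmdef
  have ham : PadicInt.toZModPow (n + 1)
      (ZpExtension.artinExponent (K.restrictOfFinrankEqTwo (by decide) Φ.Kcm Φ.finrank_Kcm) (Ideal.span {((β : ℕ) : 𝓞 Φ.Kcm)})) =
        (m : ZMod (7 ^ (n + 1))) := by
    haveI : NeZero (7 ^ (n + 1)) := ⟨pow_ne_zero _ (by norm_num)⟩
    rw [hmdef, ZMod.natCast_zmod_val]
  have h𝔟0 : Ideal.span {((β : ℕ) : 𝓞 Φ.Kcm)} ≠ ⊥ := by
    rw [Ne, Ideal.span_singleton_eq_bot]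
    exact hβ0
  have h𝔟7 : IsCoprime (Ideal.span {((β : ℕ) : 𝓞 Φ.Kcm)}) (Ideal.span {((7 : ℕ) : 𝓞 Φ.Kcm)}) :=
    (Ideal.isCoprime_span_singleton_iff _ _).mpr (Nat.Coprime.cast (hβc.coprime_dvd_right ⟨6 * (7 * F.d), by ring⟩))
  have hχβ : heckeIdealValue χ (Ideal.span {((β : ℕ) : 𝓞 Φ.Kcm)}) = (((χ Φ.γK : ℂˣ)) : ℂ) ^ m :=
    ZpExtension.heckeIdealValue_eq_pow_of_isCoprime _ Φ.isTopGenerator_γK χ hχ h𝔟0 h𝔟7 ham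
  have hζinv : ((((χ Φ.γK : ℂˣ)) : ℂ) ^ m)⁻¹ = ((((χ Φ.γK)⁻¹ : ℂˣ)) : ℂ) ^ m := by
    rw [Units.val_inv_eq_inv_val, inv_pow]
  have hβC0 : (β : ℂ) ≠ 0 := by exact_mod_cast (show β ≠ 0 by omega)
  have hβζ : (β : ℂ) - ((((χ Φ.γK)⁻¹ : ℂˣ)) : ℂ) ^ m ≠ 0 := by
    intro h0
    have h1 : ((β ^ 7 ^ (n + 1) : ℕ) : ℂ) = 1 := by
      rw [Nat.cast_pow, sub_eq_zero.mp h0, ← pow_mul, mul_comm, pow_mul, hζN, one_pow]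
    have h2 : β ^ 7 ^ (n + 1) = 1 := by exact_mod_cast h1
    have h3 : β = 1 :=
      Nat.pow_left_injective (n := 7 ^ (n + 1)) (pow_ne_zero _ (by norm_num)) (show β ^ 7 ^ (n + 1) = 1 ^ 7 ^ (n + 1) by
        rw [one_pow]; exact h2)
    omega
  -- (F) at `(β)`, read through `valOf`
  have hFβ := hF β hβ hβc hβf
  rw [← heuK] at hFβ
  have hFv := congrArg (Φ.valOf ι₇ χ) hFβ
  rw [Φ.valOf_smul ι₇ χ hχ ((((β : ℕ) : ℤ) : IwasawaAlgebra 7) * (((7 : ℕ) : IwasawaAlgebra 7) ^ t * M)),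
    Φ.valOf_euK ι₇ _ hTw (n + 1) χ hχ Lf hLf, hψβ, hχβ, hζinv,
    Φ.valOf_smul ι₇ χ hχ (((Ideal.absNorm (Ideal.span {((β : ℕ) : 𝓞 Φ.Kcm)}) : ℕ) : IwasawaAlgebra 7)),
    Φ.valOf_C_smul, sub_smul, map_sub, Φ.valOf_smul ι₇ χ hχ ((((β : ℕ) : ℤ)) : IwasawaAlgebra 7),
    Φ.valOf_binomialSeries_smul ι₇ χ hχ ham, map_add, Φ.valOf_C_smul, Φ.valOf_C_smul, Φ.valOf_C_smul, hE2,
    Φ.valOf_smul ι₇ χ hχ (w : IwasawaAlgebra 7), hN𝔟] at hFv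
  simp only [map_mul, map_pow, map_natCast, map_ofNat, Int.cast_natCast, Nat.cast_pow, Nat.cast_ofNat] at hFv
  -- (P), read through `valOf` after `res`
  have hPv := congrArg (Φ.valOf ι₇ χ) (congrArg (I.resOver Φ.IK hγ Φ.isTopGenerator_γK) hP)
  simp only [map_smul] at hPv
  rw [Φ.valOf_smul ι₇ χ hχ, Φ.valOf_smul ι₇ χ hχ] at hPv
  simp only [map_mul, map_pow, map_ofNat, Nat.cast_ofNat] at hPv
  -- the unit `uStar = u₁·w⁻¹` read
  rw [Φ.valOf_units_inv_smul ι₇ χ hχ, Units.val_mul, map_mul, map_units_inv]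
  -- notation (the evaluation character `ρ`, the CM scalar `μC = ±ιC(√−7)`, the two values `V, V₁`)
  set ρ := CharacterEvaluation.evalHom ι₇ ((((χ Φ.γK)⁻¹ : ℂˣ)) : ℂ) ⟨n + 1, Φ.inv_chi_γK_pow_eq_one χ hχ⟩ with hρ
  set μC : ℂ := (ε : ℂ) * Φ.ιC (algebraMap Φ.Kcm (AlgebraicClosure Φ.Kcm) Φ.sqrtNegSeven) with hμC
  set V : ℂ := Φ.valOf ι₇ χ (I.resOver Φ.IK hγ Φ.isTopGenerator_γK y) with hV
  set V₁ : ℂ := Φ.valOf ι₇ χ (I.resOver Φ.IK hγ Φ.isTopGenerator_γK Φ.zOne) with hV₁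
  have hρM : ρ M ≠ 0 := by
    have h := hn₀ n hn χ hprim
    rwa [CharacterEvaluation.charEval_eq_evalHom ι₇ (Φ.inv_chi_γK_pow_eq_one χ hχ)] at h
  have hρu₁ : ρ u₁ ≠ 0 := CharacterEvaluation.evalHom_units_ne_zero ι₇ _ _ u₁
  have hρw : ρ w ≠ 0 := CharacterEvaluation.evalHom_units_ne_zero ι₇ _ _ w
  -- (★★) after cancelling `β²(β − ζ^m) ≠ 0`
  have hFF : (7 : ℂ) ^ t * ρ M * Φ.Ω⁻¹ * Lf 1 =
      (ι₇ (((D₃.u : ℤ_[7]) * α₀ : ℤ_[7]) : ℚ_[7]) + ι₇ (((D₃.u : ℤ_[7]) ^ 2 * α₁ : ℤ_[7]) : ℚ_[7]) * μC) * ρ w * V := by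
    have h3 : ((β : ℂ) ^ 2 * ((β : ℂ) - ((((χ Φ.γK)⁻¹ : ℂˣ)) : ℂ) ^ m)) * ((7 : ℂ) ^ t * ρ M * Φ.Ω⁻¹ * Lf 1) =
        ((β : ℂ) ^ 2 * ((β : ℂ) - ((((χ Φ.γK)⁻¹ : ℂˣ)) : ℂ) ^ m)) *
          ((ι₇ (((D₃.u : ℤ_[7]) * α₀ : ℤ_[7]) : ℚ_[7]) + ι₇ (((D₃.u : ℤ_[7]) ^ 2 * α₁ : ℤ_[7]) : ℚ_[7]) * μC) * ρ w * V) := by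
      simp only [PadicInt.coe_mul, PadicInt.coe_pow, map_mul, map_pow]
      linear_combination hFv
    exact mul_left_cancel₀ (mul_ne_zero (pow_ne_zero _ hβC0) hβζ) h3
  -- `ν = ν_u · 7^j` read in `ℂ`, and the inverse of `ι₇ ν_u`
  have hνC : ι₇ ((((D₃.u : ℤ_[7]) * α₀) ^ 2 + 7 * ((D₃.u : ℤ_[7]) ^ 2 * α₁) ^ 2 : ℤ_[7]) : ℚ_[7]) =
      ι₇ ((PadicInt.unitCoeff hν0 : ℤ_[7]) : ℚ_[7]) *
        (7 : ℂ) ^ (((D₃.u : ℤ_[7]) * α₀) ^ 2 + 7 * ((D₃.u : ℤ_[7]) ^ 2 * α₁) ^ 2).valuation := by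
    conv_lhs => rw [hνfac]
    simp only [PadicInt.coe_mul, PadicInt.coe_pow, map_mul, map_pow, Nat.cast_ofNat, h7]
  have hιnu : ι₇ ((PadicInt.unitCoeff hν0 : ℤ_[7]) : ℚ_[7]) ≠ 0 := by
    rw [map_ne_zero]
    exact PadicInt.coe_ne_zero.mpr (Units.ne_zero _)
  have hιnuinv : ι₇ ((((PadicInt.unitCoeff hν0)⁻¹ : ℤ_[7]ˣ) : ℤ_[7]) : ℚ_[7]) = (ι₇ ((PadicInt.unitCoeff hν0 : ℤ_[7]) : ℚ_[7]))⁻¹ :=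
    (inv_eq_of_mul_eq_one_left (by rw [← map_mul, ← PadicInt.coe_mul, Units.inv_mul, PadicInt.coe_one, map_one])).symm
  -- step 3: `7^{a₁} · val · A = 7^{a₂+k+t} · Ω⁻¹ · Lf 1`
  have step3 : (7 : ℂ) ^ a₁ * ((ρ ↑u₁ * (ρ ↑w)⁻¹)⁻¹ * V₁) *
      (ι₇ (((D₃.u : ℤ_[7]) * α₀ : ℤ_[7]) : ℚ_[7]) + ι₇ (((D₃.u : ℤ_[7]) ^ 2 * α₁ : ℤ_[7]) : ℚ_[7]) * μC) =
      (7 : ℂ) ^ (a₂ + Φ.k + t) * Φ.Ω⁻¹ * Lf 1 := by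
    calc (7 : ℂ) ^ a₁ * ((ρ ↑u₁ * (ρ ↑w)⁻¹)⁻¹ * V₁) *
          (ι₇ (((D₃.u : ℤ_[7]) * α₀ : ℤ_[7]) : ℚ_[7]) + ι₇ (((D₃.u : ℤ_[7]) ^ 2 * α₁ : ℤ_[7]) : ℚ_[7]) * μC)
        = (ρ ↑u₁)⁻¹ * ((7 : ℂ) ^ a₁ * ρ M * V₁) * (ρ M)⁻¹ *
            ((ι₇ (((D₃.u : ℤ_[7]) * α₀ : ℤ_[7]) : ℚ_[7]) + ι₇ (((D₃.u : ℤ_[7]) ^ 2 * α₁ : ℤ_[7]) : ℚ_[7]) * μC) * ρ ↑w) := by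
          field_simp
      _ = (ρ ↑u₁)⁻¹ * (ρ ↑u₁ * (7 : ℂ) ^ a₂ * (7 : ℂ) ^ Φ.k * V) * (ρ M)⁻¹ *
            ((ι₇ (((D₃.u : ℤ_[7]) * α₀ : ℤ_[7]) : ℚ_[7]) + ι₇ (((D₃.u : ℤ_[7]) ^ 2 * α₁ : ℤ_[7]) : ℚ_[7]) * μC) * ρ ↑w) := by
          rw [hPv]
      _ = (7 : ℂ) ^ a₂ * (7 : ℂ) ^ Φ.k * (ρ M)⁻¹ *
            ((ι₇ (((D₃.u : ℤ_[7]) * α₀ : ℤ_[7]) : ℚ_[7]) + ι₇ (((D₃.u : ℤ_[7]) ^ 2 * α₁ : ℤ_[7]) : ℚ_[7]) * μC) * ρ ↑w * V) := by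
          field_simp
      _ = (7 : ℂ) ^ a₂ * (7 : ℂ) ^ Φ.k * (ρ M)⁻¹ * ((7 : ℂ) ^ t * ρ M * Φ.Ω⁻¹ * Lf 1) := by rw [hFF]
      _ = (7 : ℂ) ^ (a₂ + Φ.k + t) * Φ.Ω⁻¹ * Lf 1 := by
          field_simp
          ring
  -- step 4: multiply by the conjugate (`A·Ā = ι₇ ν = ι₇ ν_u · 7^j`) and divide by `ι₇ ν_u`
  have step4 := congrArg (· * (ι₇ (((D₃.u : ℤ_[7]) * α₀ : ℤ_[7]) : ℚ_[7]) -
    ι₇ (((D₃.u : ℤ_[7]) ^ 2 * α₁ : ℤ_[7]) : ℚ_[7]) * μC)) step3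
  rw [mul_assoc _ (ι₇ _ + _) (ι₇ _ - _), hAB, hνC] at step4
  calc (7 : ℂ) ^ (a₁ + (((D₃.u : ℤ_[7]) * α₀) ^ 2 + 7 * ((D₃.u : ℤ_[7]) ^ 2 * α₁) ^ 2).valuation) *
        ((ρ ↑u₁ * (ρ ↑w)⁻¹)⁻¹ * V₁)
      = (7 : ℂ) ^ (a₂ + Φ.k + t) * Φ.Ω⁻¹ * Lf 1 *
          (ι₇ (((D₃.u : ℤ_[7]) * α₀ : ℤ_[7]) : ℚ_[7]) - ι₇ (((D₃.u : ℤ_[7]) ^ 2 * α₁ : ℤ_[7]) : ℚ_[7]) * μC) *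
            (ι₇ ((PadicInt.unitCoeff hν0 : ℤ_[7]) : ℚ_[7]))⁻¹ := by
        rw [← step4]
        field_simp
        ring
    _ = _ := by
        rw [hμC]
        simp only [PadicInt.coe_mul, PadicInt.coe_pow, PadicInt.coe_neg, PadicInt.coe_intCast, map_mul, map_pow, map_neg,
          map_intCast, Nat.cast_pow, Nat.cast_ofNat, hιnuinv, h7]
        ring
  · -- POSITION: `v(α₀′² + 7α₁′²) − 2e′ = 2(a₂ + k + t) + j − 2a₁ − 2j = 2k + (2(a₂ − a₁) + 2t − j)`, `j = v(α₀² + 7α₁²)` (parity), then (E″)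
    have hε2 : ((ε : ℤ) : ℤ_[7]) ^ 2 = 1 := by rcases hε with rfl | rfl <;> norm_num
    have hsq : (((7 ^ (a₂ + Φ.k + t) : ℕ) : ℤ_[7]) * ((PadicInt.unitCoeff hν0)⁻¹ : ℤ_[7]ˣ) * ((D₃.u : ℤ_[7]) * α₀)) ^ 2 +
        7 * (-(ε : ℤ_[7]) * (((7 ^ (a₂ + Φ.k + t) : ℕ) : ℤ_[7]) * ((PadicInt.unitCoeff hν0)⁻¹ : ℤ_[7]ˣ) *
          ((D₃.u : ℤ_[7]) ^ 2 * α₁))) ^ 2 =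
        ((((PadicInt.unitCoeff hν0)⁻¹ : ℤ_[7]ˣ) : ℤ_[7]) * ((7 : ℤ_[7]) ^ (a₂ + Φ.k + t))) ^ 2 *
          (((D₃.u : ℤ_[7]) * α₀) ^ 2 + 7 * ((D₃.u : ℤ_[7]) ^ 2 * α₁) ^ 2) := by
      push_cast
      linear_combination (7 * ((7 : ℤ_[7]) ^ (a₂ + Φ.k + t)) ^ 2 *
        ((((PadicInt.unitCoeff hν0)⁻¹ : ℤ_[7]ˣ) : ℤ_[7])) ^ 2 * ((D₃.u : ℤ_[7]) ^ 2 * α₁) ^ 2) * hε2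
    have hc0 : (((PadicInt.unitCoeff hν0)⁻¹ : ℤ_[7]ˣ) : ℤ_[7]) * ((7 : ℤ_[7]) ^ (a₂ + Φ.k + t)) ≠ 0 :=
      mul_ne_zero (Units.ne_zero _) (pow_ne_zero _ (by norm_num))
    have hv7 : (7 : ℤ_[7]).valuation = 1 := by
      have h := PadicInt.valuation_p (p := 7)
      simpa using h
    have hvsq : ((((7 ^ (a₂ + Φ.k + t) : ℕ) : ℤ_[7]) * ((PadicInt.unitCoeff hν0)⁻¹ : ℤ_[7]ˣ) * ((D₃.u : ℤ_[7]) * α₀)) ^ 2 +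
        7 * (-(ε : ℤ_[7]) * (((7 ^ (a₂ + Φ.k + t) : ℕ) : ℤ_[7]) * ((PadicInt.unitCoeff hν0)⁻¹ : ℤ_[7]ˣ) *
          ((D₃.u : ℤ_[7]) ^ 2 * α₁))) ^ 2).valuation =
        2 * (a₂ + Φ.k + t) + (((D₃.u : ℤ_[7]) * α₀) ^ 2 + 7 * ((D₃.u : ℤ_[7]) ^ 2 * α₁) ^ 2).valuation := by
      rw [hsq, PadicInt.valuation_mul (pow_ne_zero _ hc0) hν0, PadicInt.valuation_pow,
        PadicInt.valuation_mul (Units.ne_zero _) (pow_ne_zero _ (by norm_num)), PadicInt.valuation_pow, hv7,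
        valuation_units_eq_zero]
      ring
    -- parity: `j = v(α₀² + 7α₁²)` (`D₃.u ∈ ℤ₇ˣ`)
    have hjJ : (((D₃.u : ℤ_[7]) * α₀) ^ 2 + 7 * ((D₃.u : ℤ_[7]) ^ 2 * α₁) ^ 2).valuation = (α₀ ^ 2 + 7 * α₁ ^ 2).valuation := by
      have h := valuation_sq_add_seven_mul_sq_units D₃.u (D₃.u ^ 2) hα
      simpa only [Units.val_pow_eq_pow_val] using h
    zify at hvsq hjJ
    push_cast at hvsq hjJ ⊢
    linarith [hEx, hvsq, hjJ]

end Frame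

end Summit.BirchSwinnertonDyer.Rank1Residual.Additive.GenusSeven

end
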